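/-
Copyright (c) 2026 the pub-hodgecm-mathlib formalisation cell (harness21).  Prover seat hodgecm-mathlib-B-p04 (g61), req618 STAGE 1a «FOUR-FRAME» squad, Track A TIER 2
for the tier-1 socket `U1_Frames` (assembler B-p04): the SELF-DUAL DESCENT STEP of A-2↓ (`stub_U1_exists_axisStable_vertex_dist_le`).  2026-09-03.
-/
import Literature.NumberTheory.Automorphic.UnitaryThreeFourFrameDefectModuleShape          -- ★ p854564: `frameProj_mulVec`; brings ★ #0a tokens and ★ p854563 `frameProj_mul_self`
import Literature.NumberTheory.Automorphic.UnitaryLatticeTreeApartment                      -- ★ `dualLatt_eq_self_of_isSelfDualLattice`; brings ★ Types ∕ Dual (`dualLatt_scaleLattice`, `latt_le_dualLatt_latt_iff`, …)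
import Literature.NumberTheory.Automorphic.UnitaryLatticeTreeFramed                         -- ★ `exists_eq_latt_of_latt_le_of_le_latt` (squeezed lattices are framed, over a principal `𝒪`)
import Literature.NumberTheory.Automorphic.UnitaryLatticeTreeIsTree                         -- ★ `v_det_antidiagonal_three`
import Literature.RingTheory.DiscreteValuationRing.ValuedIntegerPrincipalIdealRing          -- ★ p854673 (B-p04): `isPrincipalIdealRing_valuedInteger` (PIR at every `ℤᵐ⁰`-valued field)
import Literature.NumberTheory.Automorphic.UnitaryLatticeTreeIsocelesAdaptedFrameRamified   -- ★ `map_antidiagonal_three_over_apply_eq` (`Φ₃` is `σ`-hermitian); brings ★ `pairing_comm_of_hermitian` (BlockGluing)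
import HarnessLib

/-!
# (D-RAM) «FOUR-FRAME» road, unit (i), TIER 2: the SELF-DUAL DESCENT STEP of A-2↓ — from a self-dual vertex `L` with `ϖ^{c+1}·π·L ⊆ L` to the vertex
# `N = L ∩ (ϖ^c π)⁻¹ L` below it with `ϖ^c·π·N ⊆ N` (Kottwitz 1986 §1; Serre, *Trees* II.1.1; Bruhat–Tits 1972 §10)

Topic `NumberTheory/Automorphic`; namespace `Literature.NumberTheory.Automorphic.UnitaryThreeFourFrame`.  THEOREMS ONLY; abstract currency (`K` any field with `Valued K ℤᵐ⁰`,
`σ` an isometric involution, `ϖ` a uniformiser, `Φ₃ = (StdForm.antidiagonal 3).over K`, `π = frameProj σ f` for a frame vector `f` with `N(f) ≠ 0`).  Cell `pub/hodgecm-mathlib`,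
crux H413; tier-1 socket `U1_Frames` stub U1-2 (A-2↓ «a `π`-stable vertex within distance `c` of every vertex of axis exponent `≤ c`»): this file is the descent step from a
SELF-DUAL vertex; the step from a type-2 vertex and the induction are the sequel.

THE MATHEMATICS.  `T := ϖ^c π` satisfies `T² = ϖ^c T` (`π² = π`) and is self-adjoint up to the unit `σ(ϖ)^c∕ϖ^c` (`π` is `Φ₃`-self-adjoint: §1).  For a self-dual `L` (`L^♯ = L`)
with `ϖTL ⊆ L` put `N := L ∩ T⁻¹L`.  Then `ϖL ⊆ N ⊆ L` and `TN ⊆ N` (§2); `N` is FRAMED (`= latt g`: squeezed between `latt (ϖ•g₀)` and `latt g₀` over the principal ring `𝒪`,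
★ `exists_eq_latt_of_latt_le_of_le_latt` + ★ `isPrincipalIdealRing_valuedInteger`); `N ⊆ L = L^♯ ⊆ N^♯`; and `ϖN^♯ ⊆ N`: `N^♯ ⊆ (ϖL)^♯ = ϖ⁻¹L` gives `ϖN^♯ ⊆ L`, and
`T(ϖN^♯) ⊆ L = L^♯` because `⟨L, T ϖ N^♯⟩ = unit·⟨ϖTL, N^♯⟩ ⊆ ⟨N, N^♯⟩ ⊆ 𝒪` (`ϖTL ⊆ N` by `T(ϖTx) = ϖ^c(ϖTx)`).  So `N` is a VERTEX (sandwich ⇒ Gram and `ϖ·Gram⁻¹` integral),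
contained in `L`, hence equal or adjacent to `L` in the lattice graph (§3, in the currency of ★ `AxisStable` ∕ ★ `latticeGraph`), with axis exponent `≤ c`.

HONEST LABEL: HC_CM is proved only modulo the 7 printed citations (2 remaining named inputs: hLiu418 = stmt-HodgeConjecture-24832, h413 = stmt-HodgeConjecture-24833) until rung 0
closes; `--supports stmt-HodgeConjecture-24833` helper; elementary lattice algebra.
-/

noncomputable section

open scoped Valued WithZero Matrix MatrixGroups

namespace Literature.NumberTheory.Automorphic.UnitaryThreeFourFrame

open Literature.NumberTheory.Automorphic Literature.NumberTheory.Automorphic.HermitianLattice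
  Literature.NumberTheory.Automorphic.UnitaryLatticeTree

variable {K : Type} [Field K] [Valued K ℤᵐ⁰]

/-! ## §1  The frame projection is `Φ₃`-self-adjoint (`Φ₃` is `σ`-hermitian: ★ `map_antidiagonal_three_over_apply_eq`, ★ `pairing_comm_of_hermitian`) -/

omit [Valued K ℤᵐ⁰] in
/-- **The frame projection is `Φ₃`-self-adjoint: `⟨π x, y⟩ = ⟨x, π y⟩`** (`π x = N⁻¹⟨f, x⟩ f`, `N = ⟨f, f⟩ = σN`). [cite: Jacobowitz1962, §4] [cite: Kottwitz1986BaseChangeUnits, §1 pp. 240–241] -/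
theorem pairing_frameProj_mulVec {σ : K →+* K} (hσσ : ∀ a, σ (σ a) = a) (f x y : Fin 3 → K) :
    pairing σ ((StdForm.antidiagonal 3).over K) (frameProj σ f *ᵥ x) y = pairing σ ((StdForm.antidiagonal 3).over K) x (frameProj σ f *ᵥ y) := by
  have hN : σ (pairing σ ((StdForm.antidiagonal 3).over K) f f) = pairing σ ((StdForm.antidiagonal 3).over K) f f :=
    (pairing_comm_of_hermitian hσσ (map_antidiagonal_three_over_apply_eq σ) f f).symm
  rw [frameProj_mulVec, frameProj_mulVec, map_smulₛₗ, LinearMap.smul_apply, map_smul, smul_eq_mul, smul_eq_mul, map_mul, map_inv₀, hN,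
    ← pairing_comm_of_hermitian hσσ (map_antidiagonal_three_over_apply_eq σ) f x]
  -- `N⁻¹ ⟨x, f⟩ ⟨f, y⟩ = N⁻¹ ⟨f, y⟩ ⟨x, f⟩`
  ring

/-! ## §2  The operator `T = ϖ^c π` and the descent lattice `N = L ∩ T⁻¹L` -/

omit [Valued K ℤᵐ⁰] in
/-- `T² = ϖ^c T` for `T = ϖ^c π` (`π² = π`). [cite: Kottwitz1986BaseChangeUnits, §1 pp. 240–241] -/
theorem smul_frameProj_mul_self (σ : K →+* K) {f : Fin 3 → K} (hf : pairing σ ((StdForm.antidiagonal 3).over K) f f ≠ 0) (ϖ : K) (c : ℕ) :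
    (ϖ ^ c • frameProj σ f) * (ϖ ^ c • frameProj σ f) = ϖ ^ c • (ϖ ^ c • frameProj σ f) := by
  rw [Matrix.smul_mul, Matrix.mul_smul, frameProj_mul_self σ hf]

/-- **THE SELF-DUAL DESCENT STEP.**  `σ` an isometric involution, `ϖ` a uniformiser, `π = π_f` a frame projection (`N(f) ≠ 0`), `L` a SELF-DUAL vertex of the lattice graph of
`(K³, Φ₃)` with `ϖ^{c+1}·π·L ⊆ L`.  Then `N := L ∩ (ϖ^c π)⁻¹L` is a VERTEX with `ϖ^c·π·N ⊆ N`, `ϖL ⊆ N ⊆ L` (so `N = L` or `N` is adjacent to `L`).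
[cite: Kottwitz1986BaseChangeUnits, §1 pp. 240–241] [cite: BruhatTits1972, §10] [cite: Serre1980Trees, II.1.1] -/
theorem exists_descent_of_isSelfDualLattice {σ : K →+* K} (hσσ : ∀ a, σ (σ a) = a) (hvσ : ∀ a, Valued.v (σ a) = Valued.v a) {ϖ : K}
    (hϖ : Valued.v ϖ = WithZero.exp (-1 : ℤ)) {f : Fin 3 → K} (hf : pairing σ ((StdForm.antidiagonal 3).over K) f f ≠ 0)
    {L : Submodule 𝒪[K] (Fin 3 → K)} (hL : IsSelfDualLattice σ ϖ ((StdForm.antidiagonal 3).over K) L) {c : ℕ}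
    (hc : L.map ((Matrix.toLin' (ϖ ^ (c + 1) • frameProj σ f)).restrictScalars 𝒪[K]) ≤ L) :
    ∃ N : Submodule 𝒪[K] (Fin 3 → K), IsVertex σ ϖ ((StdForm.antidiagonal 3).over K) N ∧
      N.map ((Matrix.toLin' (ϖ ^ c • frameProj σ f)).restrictScalars 𝒪[K]) ≤ N ∧ N ≤ L ∧ scaleLattice ϖ L ≤ N := by
  classical
  -- constants
  have hϖ0 : ϖ ≠ 0 := fun h => by rw [h, map_zero] at hϖ; exact WithZero.zero_ne_coe hϖ
  have hϖ1 : Valued.v ϖ ≤ 1 := by rw [hϖ, ← WithZero.exp_zero, WithZero.exp_le_exp]; omega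
  have hH : IsUnit ((StdForm.antidiagonal 3).over K).det := isUnit_iff_ne_zero.2 fun h0 => by
    have h1 := v_det_antidiagonal_three (K := K); rw [h0, map_zero] at h1; exact zero_ne_one h1
  set T : Matrix (Fin 3) (Fin 3) K := ϖ ^ c • frameProj σ f with hT_def
  set φ : (Fin 3 → K) →ₗ[𝒪[K]] (Fin 3 → K) := (Matrix.toLin' T).restrictScalars 𝒪[K] with hφ_def
  have hφ : ∀ x, φ x = T *ᵥ x := fun x => rfl
  have hTT : T * T = ϖ ^ c • T := smul_frameProj_mul_self σ hf ϖ c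
  have hT2 : ∀ x, T *ᵥ (T *ᵥ x) = ϖ ^ c • (T *ᵥ x) := fun x => by rw [Matrix.mulVec_mulVec, hTT, Matrix.smul_mulVec]
  have hTϖ : ∀ y, T *ᵥ (ϖ • y) = (ϖ ^ (c + 1) • frameProj σ f) *ᵥ y := fun y => by
    rw [Matrix.mulVec_smul, hT_def, Matrix.smul_mulVec, Matrix.smul_mulVec, smul_smul, pow_succ']
  have hcx : ∀ y ∈ L, (ϖ ^ (c + 1) • frameProj σ f) *ᵥ y ∈ L := fun y hy => hc ⟨y, hy, rfl⟩
  -- the descent lattice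
  set N : Submodule 𝒪[K] (Fin 3 → K) := L ⊓ L.comap φ with hN_def
  have hmemN : ∀ x, x ∈ N ↔ x ∈ L ∧ T *ᵥ x ∈ L := fun x => by rw [hN_def, Submodule.mem_inf, Submodule.mem_comap, hφ]
  have hNL : N ≤ L := inf_le_left
  -- `ϖ T L ⊆ N`
  have hϖTL : ∀ y ∈ L, T *ᵥ (ϖ • y) ∈ N := fun y hy => by
    rw [hmemN, hTϖ]
    refine ⟨hcx y hy, ?_⟩
    rw [← hTϖ, hT2, hTϖ]  -- `T (T (ϖ y)) = ϖ^c • T(ϖ y) = ϖ^c • (ϖ^{c+1}π) y`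
    exact smul_mem_of_v_le L (by rw [map_pow]; exact pow_le_one₀ zero_le hϖ1) (hcx y hy)
  -- (ii) `ϖL ≤ N`
  have hϖL : scaleLattice ϖ L ≤ N := by
    intro x hx
    rw [mem_scaleLattice_iff hϖ0] at hx
    have hx' : x = ϖ • (ϖ⁻¹ • x) := by rw [smul_smul, mul_inv_cancel₀ hϖ0, one_smul]
    rw [hmemN, hx']
    exact ⟨smul_mem_of_v_le L hϖ1 hx, ((hmemN _).1 (hϖTL _ hx)).1⟩
  -- (iii) `T N ≤ N`
  have hTN : N.map φ ≤ N := by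
    rintro _ ⟨x, hx, rfl⟩
    rw [SetLike.mem_coe, hmemN] at hx
    rw [hφ, hmemN, hT2]
    exact ⟨hx.2, smul_mem_of_v_le L (by rw [map_pow]; exact pow_le_one₀ zero_le hϖ1) hx.2⟩
  -- (iv) `N` is framed: squeezed between `latt (ϖ • g₀)` and `latt g₀`
  obtain ⟨g₀, hLg, -, -, -⟩ := id hL
  haveI := Literature.RingTheory.DiscreteValuationRing.isPrincipalIdealRing_valuedInteger (K := K)
  have hdet0 : (ϖ • (g₀ : Matrix (Fin 3) (Fin 3) K)).det ≠ 0 := by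
    rw [Matrix.det_smul]; exact mul_ne_zero (pow_ne_zero _ hϖ0) (Matrix.isUnits_det_units g₀).ne_zero
  obtain ⟨g, hNg⟩ := exists_eq_latt_of_latt_le_of_le_latt (Matrix.GeneralLinearGroup.mkOfDetNeZero _ hdet0) g₀ N
    (by rw [Matrix.GeneralLinearGroup.val_mkOfDetNeZero, ← scaleLattice_latt, ← hLg]; exact hϖL) (by rw [← hLg]; exact hNL)
  -- (v) `N ≤ N^♯`
  have hLdual : dualLatt σ ((StdForm.antidiagonal 3).over K) L = L := dualLatt_eq_self_of_isSelfDualLattice hvσ hH hL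
  have hNdual : N ≤ dualLatt σ ((StdForm.antidiagonal 3).over K) N :=
    hNL.trans (hLdual.symm.le.trans (dualLatt_antitone σ _ hNL))
  -- (vi) `ϖ N^♯ ≤ N`
  have hσϖ0 : σ ϖ ≠ 0 := (map_ne_zero σ).2 hϖ0
  have hvϖ0 : Valued.v ϖ ≠ 0 := (Valuation.ne_zero_iff _).2 hϖ0
  have hDL : scaleLattice ϖ (dualLatt σ ((StdForm.antidiagonal 3).over K) N) ≤ L := by
    -- `N^♯ ≤ (ϖL)^♯ = (σϖ)⁻¹ L`, so `ϖ N^♯ ≤ (ϖ∕σϖ) L = L`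
    have h1 : dualLatt σ ((StdForm.antidiagonal 3).over K) N ≤ scaleLattice (σ ϖ)⁻¹ L := by
      have h2 := dualLatt_antitone σ ((StdForm.antidiagonal 3).over K) hϖL
      rwa [dualLatt_scaleLattice σ _ hϖ0, hLdual] at h2
    intro x hx
    rw [mem_scaleLattice_iff hϖ0] at hx
    have h3 := h1 hx
    rw [mem_scaleLattice_iff (inv_ne_zero hσϖ0), inv_inv, smul_smul] at h3
    have h4 : x = (ϖ * (σ ϖ)⁻¹) • ((σ ϖ * ϖ⁻¹) • x) := by
      rw [smul_smul, mul_assoc, inv_mul_cancel_left₀ hσϖ0, mul_inv_cancel₀ hϖ0, one_smul]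
    rw [h4]
    exact smul_mem_of_v_le L (by rw [map_mul, map_inv₀, hvσ, mul_inv_cancel₀ hvϖ0]) h3
  have hϖD : scaleLattice ϖ (dualLatt σ ((StdForm.antidiagonal 3).over K) N) ≤ N := by
    intro x hx
    have hxL : x ∈ L := hDL hx
    rw [mem_scaleLattice_iff hϖ0] at hx
    obtain ⟨x', rfl⟩ : ∃ x', x = ϖ • x' := ⟨ϖ⁻¹ • x, by rw [smul_smul, mul_inv_cancel₀ hϖ0, one_smul]⟩
    rw [smul_smul, inv_mul_cancel₀ hϖ0, one_smul] at hx
    rw [hmemN]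
    refine ⟨hxL, ?_⟩
    -- `T(ϖx') ∈ L = L^♯`: test against `y ∈ L`, moving `T` across the pairing (`⟨y, T(ϖx')⟩ = unit • ⟨T(ϖy), x'⟩`, and `T(ϖy) ∈ N`, `x' ∈ N^♯`)
    rw [← hLdual, mem_dualLatt]
    intro y hy
    have hle : Valued.v (pairing σ ((StdForm.antidiagonal 3).over K) (T *ᵥ (ϖ • y)) x') ≤ 1 :=
      (mem_dualLatt σ _ N _).1 hx _ (hϖTL y hy)
    have e1 : pairing σ ((StdForm.antidiagonal 3).over K) y (T *ᵥ (ϖ • x')) =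
        ϖ * ϖ ^ c * pairing σ ((StdForm.antidiagonal 3).over K) (frameProj σ f *ᵥ y) x' := by
      rw [pairing_frameProj_mulVec hσσ f y x']
      simp only [hT_def, Matrix.mulVec_smul, Matrix.smul_mulVec, map_smul, smul_eq_mul]
      ring
    have e2 : pairing σ ((StdForm.antidiagonal 3).over K) (T *ᵥ (ϖ • y)) x' =
        σ (ϖ ^ (c + 1)) * pairing σ ((StdForm.antidiagonal 3).over K) (frameProj σ f *ᵥ y) x' := by
      rw [hTϖ, Matrix.smul_mulVec, map_smulₛₗ, LinearMap.smul_apply, smul_eq_mul]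
    have e3 : Valued.v (ϖ * ϖ ^ c * pairing σ ((StdForm.antidiagonal 3).over K) (frameProj σ f *ᵥ y) x') =
        Valued.v (σ (ϖ ^ (c + 1)) * pairing σ ((StdForm.antidiagonal 3).over K) (frameProj σ f *ᵥ y) x') := by
      simp only [map_mul, map_pow, hvσ, pow_succ']
    rw [e1, e3, ← e2]
    exact hle
  -- (vii) `N` is a vertex
  have hgdet : IsUnit (g : Matrix (Fin 3) (Fin 3) K).det := Matrix.isUnits_det_units g
  have hint : IsIntMatrix (formCongr σ g ((StdForm.antidiagonal 3).over K)) := by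
    have h := hNdual; rw [hNg] at h
    exact (latt_le_dualLatt_latt_iff σ hvσ _ _).1 h
  have hint' : IsIntMatrix (ϖ • (formCongr σ g ((StdForm.antidiagonal 3).over K))⁻¹) := by
    have h := hϖD; rw [hNg] at h
    exact (scaleLattice_dualLatt_latt_le_iff σ hvσ hH hgdet ϖ).1 h
  have hGdet : (formCongr σ g ((StdForm.antidiagonal 3).over K)).det ≠ 0 := by
    rw [formCongr, Matrix.det_mul, Matrix.det_mul]
    exact mul_ne_zero (mul_ne_zero (isUnit_det_transpose_map σ hgdet).ne_zero hH.ne_zero) hgdet.ne_zero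
  have hvG : Valued.v (formCongr σ g ((StdForm.antidiagonal 3).over K)).det ≤ 1 :=
    Literature.NumberTheory.Automorphic.CartanUnique.v_det_le_one_of_forall_v_le_one hint
  have hGdet0 : Valued.v (formCongr σ g ((StdForm.antidiagonal 3).over K)).det ≠ 0 := (Valuation.ne_zero_iff _).2 hGdet
  obtain ⟨k, hk⟩ : ∃ k : ℕ, Valued.v (formCongr σ g ((StdForm.antidiagonal 3).over K)).det = Valued.v ϖ ^ k := by
    refine ⟨(-WithZero.log (Valued.v (formCongr σ g ((StdForm.antidiagonal 3).over K)).det)).toNat, ?_⟩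
    have hm0 : WithZero.log (Valued.v (formCongr σ g ((StdForm.antidiagonal 3).over K)).det) ≤ 0 := by
      rw [WithZero.log_le_iff_le_exp hGdet0, WithZero.exp_zero]; exact hvG
    rw [hϖ, ← WithZero.exp_nsmul, nsmul_eq_mul, Int.toNat_of_nonneg (by omega), mul_neg, mul_one, neg_neg, WithZero.exp_log hGdet0]
  exact ⟨N, ⟨k, g, hNg, hint, hint', hk⟩, hTN, hNL, hϖL⟩

/-! ## §3  Graph form: the descent vertex is `L` itself or a neighbour of `L` -/

/-- **§2 in the currency of ★ `AxisStable` and the lattice graph**: from a SELF-DUAL vertex `L` with `AxisStable ϖ π L (c+1)` (`ϖ^{c+1}πL ⊆ L`) to a vertex `N`, EQUAL OR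
ADJACENT to `L` (adjacency = strict containment, ★ `latticeGraph_adj_iff`), with `AxisStable ϖ π N c`. [cite: Kottwitz1986BaseChangeUnits, §1 pp. 240–241] [cite: Serre1980Trees, II.1.1] -/
theorem exists_axisStable_eq_or_adj_of_isSelfDualLattice {σ : K →+* K} (hσσ : ∀ a, σ (σ a) = a) (hvσ : ∀ a, Valued.v (σ a) = Valued.v a) {ϖ : K}
    (hϖ : Valued.v ϖ = WithZero.exp (-1 : ℤ)) {f : Fin 3 → K} (hf : pairing σ ((StdForm.antidiagonal 3).over K) f f ≠ 0)
    {L : Submodule 𝒪[K] (Fin 3 → K)} (hL : IsSelfDualLattice σ ϖ ((StdForm.antidiagonal 3).over K) L) {c : ℕ} (hc : AxisStable ϖ (frameProj σ f) L (c + 1)) :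
    ∃ (N : Submodule 𝒪[K] (Fin 3 → K)) (hN : IsVertex σ ϖ ((StdForm.antidiagonal 3).over K) N), AxisStable ϖ (frameProj σ f) N c ∧ N ≤ L ∧
      (N = L ∨ (latticeGraph σ ϖ ((StdForm.antidiagonal 3).over K)).Adj ⟨L, ⟨0, hL⟩⟩ ⟨N, hN⟩) := by
  obtain ⟨N, hN, hTN, hNL, -⟩ := exists_descent_of_isSelfDualLattice hσσ hvσ hϖ hf hL hc
  refine ⟨N, hN, hTN, hNL, ?_⟩
  rcases eq_or_lt_of_le hNL with h | h
  · exact Or.inl h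
  · exact Or.inr ((latticeGraph_adj_iff σ ϖ _ _ _).2 (Or.inr h))

end Literature.NumberTheory.Automorphic.UnitaryThreeFourFrame

end
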